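import Mathlib
import HarnessLib
import Literature.AlgebraicGeometry.Hassett2000.TwoPlanePencilDiscriminants

/-!
# Cubic `2k`-folds containing a cubic `k`-fold scroll: Hassett's `𝒞₁₂` parameter count and its `k`-fold analogue

B. Hassett, *Special cubic fourfolds*, Compositio Math. 120 (2000) 1–23, §4.1.2 ("d=12: Cubic fourfolds
containing a cubic scroll"), Lemma 4.1.1 and the paragraph after it [cite: Hassett2000, Lemma 4.1.1], verbatim:
"Let `X` be a general cubic fourfold containing a rational normal cubic scroll `T`. Then the scrolls in `X`
rationally equivalent to `T` form a two parameter family." … "the equation of a cubic threefold containing a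
cubic scroll is the determinant of a `3 × 3` matrix. … The Hilbert scheme of cubic scrolls in `ℙ⁴` has
dimension `18`, and each scroll is contained in a twelve-dimensional system of cubic threefolds." … "The
Hilbert scheme of cubic scrolls in `ℙ⁵` is irreducible of dimension `5 + 24 − 6 = 23`. Any given scroll is
contained in a projective space of cubic hypersurfaces of dimension `55 − 22 = 33`, so `W` is irreducible of
dimension `56`. However, each cubic fourfold containing a cubic scroll contains a two parameter family of
such scrolls, so the cubic fourfolds containing a cubic scroll form a divisor in `𝒞`. This coincides with
`𝒞₁₂`."

The same fibre-dimension count is the printed template for Hodge loci of complete-intersection classes: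
R. Kloosterman, *Variational Hodge conjecture for complete intersections on hypersurfaces in projective
space*, Rend. Sem. Mat. Univ. Padova 148 (2023) 185–201, Prop. 3.2 (flag Hilbert scheme, fibre dimension
`= h⁰(N_{Z/Y})`-bound realised by an explicit family, `codim L = h_{I(Z)}(e) + c − dim H`) and Thm. 4.14
(`dim_Y NL(γ) ≤ dim T_Y NL(γ) = dim L ≤ dim_Y NL(γ)` ⟹ the Hodge locus is the locus of hypersurfaces
containing the cycle, smooth at `Y`) [cite: Kloosterman2023, Prop. 3.2 and Thm. 4.14].

What this file PROVES (arithmetic and one determinant identity; no geometry is formalised, NO fact is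
introduced):
* `scrollSections k t = C(t+k−1, t) + 3·C(t+k−1, t−1)` — the Hilbert function `h⁰(𝒪_S(t))` of a
  `k`-dimensional rational normal scroll `S = S(a₁,…,a_k)` of degree `Σ aᵢ = 3` (spanning `ℙ^{k+2}`;
  `h⁰(ℙ(E), 𝒪(t)) = Σ_{|m|=t} (m·a + 1)` [folklore]); the printed values `k = 2`: `5, 22` (spans `ℙ⁴`;
  `35 − 22 − 1 = 12`, `56 − 22 − 1 = 33`) and the values `k = 3,…,7` used by the pub-hlocus census
  (`40, 65, 98, 140, 192`);
* `cubicScrollFamilyDim k = k² + 8k + 3 = (k−1)(k+3) + (6k+6)` (span `ℙ^{k+2} ⊂ ℙ^{2k+1}`, then the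
  `PGL_{k+3}`-orbit of `S(1,1,1,0,…,0)`; `k = 2` gives Hassett's `5 + 24 − 6 = 23`) — a DEFINITION by the
  closed form, justified in the docstring, not a vendored fact;
* the incidence/fibre count with fibre dimension `2`: `scrollIncidenceDim 2 = 56`, `scrollLocusDim 2 = 54 =
  55 − 1` (Hassett's divisor `𝒞₁₂`), and `scrollLocusCodim k = h⁰(𝒪_S(3)) − (k²+8k+3) + 2` with values
  `1, 6, 16, 32, 55, 86` for `k = 2,…,7`;
* `planePairLocusCodim k = 2·C(k+3,3) − C(k+1,3) − (k²+6k+1)` — codimension, among cubic `2k`-folds, of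
  those containing two `k`-planes meeting in a `ℙ^{k−2}` (pairs: `(k−1)(k+3) + 4(k+1)`; `h⁰(𝒪_{Π₁∪Π₂}(3)) =
  2C(k+3,3) − C(k+1,3)`) [folklore parameter count]; values `2, 8, 19, 36, 60, 92`;
* the EXCESS IDENTITY `planePairLocusCodim k − scrollLocusCodim k = k − 1` for every `k ≥ 1` (Pascal's rule,
  `excess_eq`), and `cubicModuliDim (2k) − scrollLocusCodim k = 19, 50, 104, 188, 309, 474` (`k = 2,…,7`);
* the determinant identity behind "the equation of a cubic … containing a cubic scroll is the determinant of a
  `3 × 3` matrix": for any `3 × 3` matrix `N` over a commutative ring, `det N` is the row-`2` combination of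
  the three `2 × 2` minors of rows `0,1` (`det_eq_row_two_combination`), hence lies in the ideal they generate,
  and so does `det g · det N` w.r.t. the minors of the first two rows of `g * N` for every `g`
  (`det_mul_mem_span_rowMinors`) — the two-parameter family of scrolls `{rank(rows of a 2-plane of g·N) ≤ 1}`
  inside the fixed cubic `{det N = 0}`.

USE (cell pub-hlocus, OI-1 / COMPONENTS.md rows C3 and S; HOME/pub-hlocus-lit-g4/LIT-ANSWERS-g4.md §G4-A):
the census measured, at the Fermat cubic `2k`-fold, `codim T_F V_δ = 1, 6, 16, 32, 55, 86` for
`δ = [Π₁] − [Π₂]`, `k = 2,…,7` (exact IVHS ranks, two routes) — these ARE `scrollLocusCodim k`, i.e. the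
codimension of the locus `L_k` of cubic `2k`-folds containing a cubic `k`-fold scroll PROVIDED the generic
fibre dimension is `2`; the lit seat computed `dim T_S Hilb(Y) = 2` for a cubic `Y ⊃ S` (k = 2,…,7, exact
over `ℚ` / two primes; one implementation, countersign requested). With Kloosterman's Thm. 4.14 argument this
gives `V_δ = ` (branch of) `L_k` at Fermat, smooth of dimension `cubicModuliDim (2k) − scrollLocusCodim k` —
Movasati's "generalized cubic scroll" conjecture (arXiv:2211.11405, Conj. 7 [cite: Movasati2022HodgeLocus,
Conj. 7]) at the Fermat point, modulo the cell's two-implementation rule. None of those measured numbers is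
vendored here as a fact; the theorems below are statements about the closed forms.
HONEST FRAMING (cell pub-hlocus): certified instances and evidence bearing on the general Hodge conjecture;
no claim.
-/

namespace Literature.AlgebraicGeometry.Hassett2000

open Matrix

/-! ## Hilbert function of a cubic `k`-fold scroll -/

/-- `h⁰(𝒪_S(t))` for a `k`-dimensional rational normal scroll of degree `3`, `S = ℙ(E)`,
`E = ⊕ 𝒪_{ℙ¹}(aᵢ)`, `Σ aᵢ = 3`: `Σ_{|m| = t} (m·a + 1) = C(t+k−1, k−1) + 3·C(t+k−1, k)`, written with
`C(t+k−1,k−1) = C(t+k−1,t)` and `C(t+k−1,k) = C(t+k−1,t−1)`; independent of the splitting type `a`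
(all such scrolls, cones included, have Hilbert series `(1+2z)/(1−z)^{k+1}`). [folklore] -/
def scrollSections (k t : ℕ) : ℕ := (t + k - 1).choose t + 3 * (t + k - 1).choose (t - 1)

/-- `k = 2`, `t = 1`: a cubic scroll surface spans a `ℙ⁴` ("the hyperplane section containing `T`").
[cite: Hassett2000, Lemma 4.1.1] -/
theorem scrollSections_two_one : scrollSections 2 1 = 5 := by decide

/-- `k = 2`, `t = 3`: `h⁰(𝒪_T(3)) = 22`, the number in Hassett's "`55 − 22 = 33`".
[cite: Hassett2000, Lemma 4.1.1] -/
theorem scrollSections_two_three : scrollSections 2 3 = 22 := by decide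

/-- "each scroll is contained in a twelve-dimensional system of cubic threefolds" (in `ℙ⁴`:
`C(7,3) − 22 − 1 = 12`) and "a projective space of cubic hypersurfaces of dimension `55 − 22 = 33`"
(in `ℙ⁵`). [cite: Hassett2000, Lemma 4.1.1] -/
theorem hassett_cubics_through_scroll :
    (Nat.choose 7 3 : ℤ) - scrollSections 2 3 - 1 = 12 ∧ (Nat.choose 8 3 : ℤ) - 1 - scrollSections 2 3 = 33 := by
  decide

/-- The degree-`2` and degree-`3` values for `k = 3,…,7` (`18/40, 25/65, 33/98, 42/140, 52/192`), the
Hilbert-function values re-derived by the census's Hom computation (pub-hlocus lit-g4, `scroll_normal.py`).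
[folklore] -/
theorem scrollSections_table :
    scrollSections 3 2 = 18 ∧ scrollSections 3 3 = 40 ∧ scrollSections 4 2 = 25 ∧ scrollSections 4 3 = 65 ∧
    scrollSections 5 2 = 33 ∧ scrollSections 5 3 = 98 ∧ scrollSections 6 2 = 42 ∧ scrollSections 6 3 = 140 ∧
    scrollSections 7 2 = 52 ∧ scrollSections 7 3 = 192 := by
  decide

/-- Closed form in degree `3` without truncated subtraction: for `k ≥ 1`,
`h⁰(𝒪_S(3)) = C(k+2,3) + 3·C(k+2,2)`. [folklore] -/
theorem scrollSections_three (j : ℕ) :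
    scrollSections (j + 1) 3 = (j + 3).choose 3 + 3 * (j + 3).choose 2 := by
  unfold scrollSections
  have e1 : 3 + (j + 1) - 1 = j + 3 := by omega
  rw [e1, Nat.choose_symm_of_eq_add (by omega : j + 3 = 3 + j), show (3 - 1 : ℕ) = 2 from rfl,
    Nat.choose_symm_of_eq_add (by omega : j + 3 = 2 + (j + 1))]

/-! ## The family of cubic `k`-fold scrolls in `ℙ^{2k+1}` and the incidence count -/

/-- Dimension of the family `H_k` of cubic `k`-fold scrolls in `ℙ^{2k+1}`: choice of the span
`ℙ^{k+2} ⊂ ℙ^{2k+1}` (`(k−1)(k+3)` parameters) and of a scroll spanning it (the `PGL_{k+3}`-orbit of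
`S(1,1,1,0,…,0)`, of dimension `6k + 6`: `18` for `k = 2`, `24 = 35 − 11` for the Segre `ℙ¹ × ℙ²`);
total `k² + 8k + 3`.  For `k = 2` this is Hassett's "`5 + 24 − 6 = 23`" [cite: Hassett2000, Lemma 4.1.1];
for `k = 3,…,7` the census recomputed it as the rank of the `𝔤𝔩_{2k+2}`-image in `Hom(I_S, S/I_S)₀`
(`36, 51, 68, 87, 108`). A definition by the closed form. [folklore] -/
def cubicScrollFamilyDim (k : ℕ) : ℤ := (k : ℤ) ^ 2 + 8 * k + 3

/-- `k² + 8k + 3 = (k−1)(k+3) + (6k+6)`. [folklore] -/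
theorem cubicScrollFamilyDim_eq (k : ℕ) :
    cubicScrollFamilyDim k = ((k : ℤ) - 1) * (k + 3) + (6 * k + 6) := by
  unfold cubicScrollFamilyDim; ring

/-- Hassett: "irreducible of dimension `5 + 24 − 6 = 23`". [cite: Hassett2000, Lemma 4.1.1] -/
theorem cubicScrollFamilyDim_two : cubicScrollFamilyDim 2 = 5 + 24 - 6 := by decide

/-- The census values `36, 51, 68, 87, 108` for `k = 3,…,7`. [folklore] -/
theorem cubicScrollFamilyDim_table :
    cubicScrollFamilyDim 3 = 36 ∧ cubicScrollFamilyDim 4 = 51 ∧ cubicScrollFamilyDim 5 = 68 ∧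
    cubicScrollFamilyDim 6 = 87 ∧ cubicScrollFamilyDim 7 = 108 := by
  decide

/-- `h_{I(S)}(3) = C(2k+4, 3) − h⁰(𝒪_S(3))`: the vector space of cubic forms on `ℙ^{2k+1}` vanishing on a
cubic `k`-fold scroll (`S` is projectively normal). [folklore] -/
def cubicsThroughScroll (k : ℕ) : ℤ := ((2 * k + 4).choose 3 : ℤ) - scrollSections k 3

/-- `k = 2`: `56 − 22 = 34` (Hassett's `ℙ³³`); `k = 3`: `120 − 40 = 80`. [cite: Hassett2000, Lemma 4.1.1] -/
theorem cubicsThroughScroll_two_three : cubicsThroughScroll 2 = 34 ∧ cubicsThroughScroll 3 = 80 := by decide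

/-- Dimension of the incidence variety `W = {(S, X) : S ⊂ X}` (scroll, cubic): `dim H_k + (h_{I(S)}(3) − 1)`.
[cite: Hassett2000, Lemma 4.1.1] for `k = 2`. -/
def scrollIncidenceDim (k : ℕ) : ℤ := cubicScrollFamilyDim k + (cubicsThroughScroll k - 1)

/-- Hassett: "`W` is irreducible of dimension `56`". [cite: Hassett2000, Lemma 4.1.1] -/
theorem scrollIncidenceDim_two : scrollIncidenceDim 2 = 56 := by decide

/-- `k = 3,…,7`: `115, 205, 333, 506, 731` (census). [folklore] -/
theorem scrollIncidenceDim_table :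
    scrollIncidenceDim 3 = 115 ∧ scrollIncidenceDim 4 = 205 ∧ scrollIncidenceDim 5 = 333 ∧
    scrollIncidenceDim 6 = 506 ∧ scrollIncidenceDim 7 = 731 := by
  decide

/-- Dimension of the image of `W` in `ℙ(S₃) = ℙ^{C(2k+4,3)−1}` when the generic cubic containing a scroll
contains an `e`-parameter family of them (fibre-dimension theorem). [cite: Kloosterman2023, Prop. 3.2] -/
def scrollLocusDim (k : ℕ) (e : ℤ) : ℤ := scrollIncidenceDim k - e

/-- Hassett: with the two-parameter family, "the cubic fourfolds containing a cubic scroll form a divisor"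
(`56 − 2 = 54 = 55 − 1`). [cite: Hassett2000, Lemma 4.1.1] -/
theorem scrollLocusDim_two : scrollLocusDim 2 2 = 54 ∧ ((Nat.choose 8 3 : ℤ) - 1) - scrollLocusDim 2 2 = 1 := by
  decide

/-- Codimension in `ℙ(S₃)` (equivalently in moduli) of the locus of cubic `2k`-folds containing a cubic
`k`-fold scroll, with fibre dimension `2`: `(C(2k+4,3) − 1) − (dim W − 2)`. [cite: Kloosterman2023, Prop. 3.2]
for the template; [cite: Hassett2000, Lemma 4.1.1] for `k = 2`. -/
def scrollLocusCodim (k : ℕ) : ℤ := (((2 * k + 4).choose 3 : ℤ) - 1) - scrollLocusDim k 2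

/-- The codimension equals `h⁰(𝒪_S(3)) − dim H_k + 2`. [folklore] -/
theorem scrollLocusCodim_eq (k : ℕ) :
    scrollLocusCodim k = (scrollSections k 3 : ℤ) - cubicScrollFamilyDim k + 2 := by
  unfold scrollLocusCodim scrollLocusDim scrollIncidenceDim cubicsThroughScroll
  ring

/-- The table `k = 2,…,7 ↦ 1, 6, 16, 32, 55, 86` — Hassett's divisor `𝒞₁₂` for `k = 2`, and exactly the
codimensions of `T_F V_{[Π₁]−[Π₂]}` measured by the pub-hlocus census at the Fermat cubic `2k`-fold for
`k = 3,…,7` (rows C3, S). [cite: Hassett2000, Lemma 4.1.1] for `k = 2`; the rest is arithmetic. -/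
theorem scrollLocusCodim_table :
    scrollLocusCodim 2 = 1 ∧ scrollLocusCodim 3 = 6 ∧ scrollLocusCodim 4 = 16 ∧ scrollLocusCodim 5 = 32 ∧
    scrollLocusCodim 6 = 55 ∧ scrollLocusCodim 7 = 86 := by
  decide

/-- Closed form: `6 · codim = (k−1)(k² + 7k − 12)` for `k ≥ 1` (e.g. `k = 8 ↦ 126`). [folklore] -/
theorem six_mul_scrollLocusCodim (j : ℕ) :
    6 * scrollLocusCodim (j + 1) = (j : ℤ) * ((j + 1) ^ 2 + 7 * (j + 1) - 12) := by
  rw [scrollLocusCodim_eq, scrollSections_three]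
  unfold cubicScrollFamilyDim
  have h3 : ((j + 3).choose 3 : ℤ) * 6 = (j + 3) * (j + 2) * (j + 1) := by
    have := Nat.choose_mul_factorial_mul_factorial (show 3 ≤ j + 3 by omega)
    rw [show j + 3 - 3 = j from by omega] at this
    have h : ((j + 3).choose 3) * 6 * j.factorial = (j + 3) * (j + 2) * (j + 1) * j.factorial := by
      have e : (j + 3).factorial = (j + 3) * (j + 2) * (j + 1) * j.factorial := by
        rw [show j + 3 = (j + 2) + 1 from rfl, Nat.factorial_succ, show j + 2 = (j + 1) + 1 from rfl,
          Nat.factorial_succ, Nat.factorial_succ]; ring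
      rw [← e, ← this, show (3 : ℕ).factorial = 6 from rfl]
    have hj : j.factorial ≠ 0 := Nat.factorial_ne_zero j
    exact_mod_cast Nat.eq_of_mul_eq_mul_right (Nat.pos_of_ne_zero hj) h
  have h2 : ((j + 3).choose 2 : ℤ) * 2 = (j + 3) * (j + 2) := by
    have := Nat.choose_mul_factorial_mul_factorial (show 2 ≤ j + 3 by omega)
    rw [show j + 3 - 2 = j + 1 from by omega] at this
    have h : ((j + 3).choose 2) * 2 * (j + 1).factorial = (j + 3) * (j + 2) * (j + 1).factorial := by
      have e : (j + 3).factorial = (j + 3) * (j + 2) * (j + 1).factorial := by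
        rw [show j + 3 = (j + 2) + 1 from rfl, Nat.factorial_succ, show j + 2 = (j + 1) + 1 from rfl,
          Nat.factorial_succ]; ring
      rw [← e, ← this, show (2 : ℕ).factorial = 2 from rfl]
    have hj : (j + 1).factorial ≠ 0 := Nat.factorial_ne_zero (j + 1)
    exact_mod_cast Nat.eq_of_mul_eq_mul_right (Nat.pos_of_ne_zero hj) h
  push_cast
  nlinarith [h3, h2]

/-! ## Two `k`-planes meeting in a `ℙ^{k−2}` and the excess -/

/-- Codimension, among cubic `2k`-folds, of those containing two `k`-planes `Π₁, Π₂ ⊂ ℙ^{2k+1}` meeting in a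
`ℙ^{k−2}`: `h⁰(𝒪_{Π₁∪Π₂}(3)) − dim{pairs} = (2C(k+3,3) − C(k+1,3)) − ((k−1)(k+3) + 4(k+1))`.
For `k = 3` this is the census's `codim NL(Π₁,Π₂) = 8` (`dim 48` in the `56`-dimensional moduli of cubic
sixfolds). [folklore] -/
def planePairLocusCodim (k : ℕ) : ℤ :=
  2 * ((k + 3).choose 3 : ℤ) - ((k + 1).choose 3 : ℤ) - ((k : ℤ) ^ 2 + 6 * k + 1)

/-- `(k−1)(k+3) + 4(k+1) = k² + 6k + 1`. [folklore] -/
theorem planePair_count (k : ℕ) : ((k : ℤ) - 1) * (k + 3) + 4 * (k + 1) = (k : ℤ) ^ 2 + 6 * k + 1 := by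
  ring

/-- Values `k = 2,…,7 ↦ 2, 8, 19, 36, 60, 92`. [folklore] -/
theorem planePairLocusCodim_table :
    planePairLocusCodim 2 = 2 ∧ planePairLocusCodim 3 = 8 ∧ planePairLocusCodim 4 = 19 ∧
    planePairLocusCodim 5 = 36 ∧ planePairLocusCodim 6 = 60 ∧ planePairLocusCodim 7 = 92 := by
  decide

/-- The excess of the scroll locus over the pair-of-planes locus it contains (the census's
`excess = codim NL(Π₁,Π₂) − codim T_F V_δ`). [folklore] -/
def excess (k : ℕ) : ℤ := planePairLocusCodim k - scrollLocusCodim k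

/-- EXCESS IDENTITY: `codim{X ⊃ Π₁ ∪ Π₂} − codim{X ⊃ cubic k-fold scroll} = k − 1` for every `k ≥ 1`
(Pascal's rule).  This is the pattern "excess `= k − 1`" observed by the census for `n = 2k = 4,…,14`
(COMPONENTS.md row S), now a consequence of the two parameter counts. [folklore] -/
theorem excess_eq (j : ℕ) : excess (j + 1) = j := by
  unfold excess planePairLocusCodim
  rw [scrollLocusCodim_eq, scrollSections_three]
  unfold cubicScrollFamilyDim
  have p1 : (j + 4).choose 3 = (j + 3).choose 2 + (j + 3).choose 3 := Nat.choose_succ_succ' (j + 3) 2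
  have p2 : (j + 3).choose 3 = (j + 2).choose 2 + (j + 2).choose 3 := Nat.choose_succ_succ' (j + 2) 2
  have p3 : (j + 3).choose 2 = (j + 2).choose 1 + (j + 2).choose 2 := Nat.choose_succ_succ' (j + 2) 1
  simp only [Nat.choose_one_right] at p3
  rw [show j + 1 + 3 = j + 4 from by ring, show j + 1 + 1 = j + 2 from by ring, p1, p2, p3]
  push_cast
  ring

/-- Instances `k = 2,…,7`: excess `1, 2, 3, 4, 5, 6`. [folklore] -/
theorem excess_table :
    excess 2 = 1 ∧ excess 3 = 2 ∧ excess 4 = 3 ∧ excess 5 = 4 ∧ excess 6 = 5 ∧ excess 7 = 6 := by decide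

/-- Predicted dimension of the Hodge locus `V_δ` in the moduli of cubic `2k`-folds
(`cubicModuliDim n = C(n+4,3) − (n+2)²`): `19` (`𝒞₁₂ ⊂ 𝒞`, `dim 𝒞 = 20`), and `50, 104, 188, 309, 474` —
the values `dim T_F V_δ` reported by the census for `n = 6, 8, 10, 12, 14`. [folklore] -/
theorem hodgeLocusDim_table :
    cubicModuliDim 4 - scrollLocusCodim 2 = 19 ∧ cubicModuliDim 6 - scrollLocusCodim 3 = 50 ∧
    cubicModuliDim 8 - scrollLocusCodim 4 = 104 ∧ cubicModuliDim 10 - scrollLocusCodim 5 = 188 ∧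
    cubicModuliDim 12 - scrollLocusCodim 6 = 309 ∧ cubicModuliDim 14 - scrollLocusCodim 7 = 474 := by
  decide

/-! ## "The equation of a cubic containing a cubic scroll is the determinant of a `3 × 3` matrix" -/

section Determinant

variable {R : Type*} [CommRing R]

/-- The three `2 × 2` minors of rows `0, 1` of a `3 × 3` matrix (columns `{1,2}`, `{0,2}`, `{0,1}`); when the
entries are linear forms on `ℙ^{k+2}` and the matrix is `1`-generic these cut out a cubic `k`-fold scroll.
[folklore] -/
def rowMinor₁₂ (N : Matrix (Fin 3) (Fin 3) R) : R := N 0 1 * N 1 2 - N 0 2 * N 1 1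

/-- See `rowMinor₁₂`. [folklore] -/
def rowMinor₀₂ (N : Matrix (Fin 3) (Fin 3) R) : R := N 0 0 * N 1 2 - N 0 2 * N 1 0

/-- See `rowMinor₁₂`. [folklore] -/
def rowMinor₀₁ (N : Matrix (Fin 3) (Fin 3) R) : R := N 0 0 * N 1 1 - N 0 1 * N 1 0

/-- Laplace expansion along the last row: `det N = N₂₀·m₁₂ − N₂₁·m₀₂ + N₂₂·m₀₁`.  Read backwards: every cubic
`Σ ℓᵢ mᵢ` in the ideal of the scroll `{m₁₂ = m₀₂ = m₀₁ = 0}` is the determinant of the `3 × 3` matrix obtained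
by appending the row `(ℓ₀, ℓ₁, ℓ₂)` — Hassett's "the equation of a cubic threefold containing a cubic scroll
is the determinant of a `3 × 3` matrix". [cite: Hassett2000, Lemma 4.1.1] -/
theorem det_eq_row_two_combination (N : Matrix (Fin 3) (Fin 3) R) :
    N.det = N 2 0 * rowMinor₁₂ N - N 2 1 * rowMinor₀₂ N + N 2 2 * rowMinor₀₁ N := by
  rw [Matrix.det_fin_three]
  unfold rowMinor₁₂ rowMinor₀₂ rowMinor₀₁
  ring

/-- Hence `{det N = 0} ⊃ {rank(rows 0,1) ≤ 1}`: `det N` lies in the ideal of the three minors. [folklore] -/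
theorem det_mem_span_rowMinors (N : Matrix (Fin 3) (Fin 3) R) :
    N.det ∈ Ideal.span ({rowMinor₁₂ N, rowMinor₀₂ N, rowMinor₀₁ N} : Set R) := by
  rw [det_eq_row_two_combination]
  have h1 : rowMinor₁₂ N ∈ Ideal.span ({rowMinor₁₂ N, rowMinor₀₂ N, rowMinor₀₁ N} : Set R) :=
    Ideal.subset_span (by simp)
  have h2 : rowMinor₀₂ N ∈ Ideal.span ({rowMinor₁₂ N, rowMinor₀₂ N, rowMinor₀₁ N} : Set R) :=
    Ideal.subset_span (by simp)
  have h3 : rowMinor₀₁ N ∈ Ideal.span ({rowMinor₁₂ N, rowMinor₀₂ N, rowMinor₀₁ N} : Set R) :=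
    Ideal.subset_span (by simp)
  refine Ideal.add_mem _ (Ideal.sub_mem _ ?_ ?_) ?_
  · exact Ideal.mul_mem_left _ _ h1
  · exact Ideal.mul_mem_left _ _ h2
  · exact Ideal.mul_mem_left _ _ h3

/-- The two-parameter family: for every `g` (a change of basis of the row space), `det g · det N` lies in the
ideal of the minors of the first two rows of `g * N`; so when `det g` is a unit the scroll
`{rank(rows 0,1 of g·N) ≤ 1}` lies in the SAME cubic `{det N = 0}`, and it depends only on the `2`-plane
spanned by rows `0, 1` of `g` — a `ℙ² = Gr(2,3)` of scrolls in the cubic (Hassett: "generally such a cubic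
threefold contains a two parameter family of cubic scrolls"). [cite: Hassett2000, Lemma 4.1.1] -/
theorem det_mul_mem_span_rowMinors (g N : Matrix (Fin 3) (Fin 3) R) :
    g.det * N.det ∈ Ideal.span ({rowMinor₁₂ (g * N), rowMinor₀₂ (g * N), rowMinor₀₁ (g * N)} : Set R) := by
  rw [← Matrix.det_mul]
  exact det_mem_span_rowMinors (g * N)

/-- In particular, if the three minors of rows `0,1` of `g * N` vanish (a point of the scroll attached to
the row-plane of `g`) and `det g` is a unit, then `det N` vanishes there. [folklore] -/
theorem det_eq_zero_of_rowMinors_mul_eq_zero (g N : Matrix (Fin 3) (Fin 3) R) (hg : IsUnit g.det)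
    (h₁₂ : rowMinor₁₂ (g * N) = 0) (h₀₂ : rowMinor₀₂ (g * N) = 0) (h₀₁ : rowMinor₀₁ (g * N) = 0) :
    N.det = 0 := by
  have h : (g * N).det = 0 := by
    rw [det_eq_row_two_combination, h₁₂, h₀₂, h₀₁]; ring
  rw [Matrix.det_mul] at h
  exact (hg.mul_right_eq_zero).mp h

end Determinant

end Literature.AlgebraicGeometry.Hassett2000
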